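import Summits.HubbardSuperconductivity.HubbardSuperconductivity.Theorems.NodalWardXYDefs

/-!
# `PerturbedXYOrder` (stmt-HubbardSuperconductivity-10739) — line `schwarz-inheritance`, stub `stub_e3HelixBox`
# (c5 tightness of the decay exponent: the 90°-helix box)

For `4 ∣ L` the 90°-helix representative
`θ_h(x) = π/4 + (π/2)·((x₀.val + x₁.val + x₂.val) mod 4) ∈ {π/4, 3π/4, 5π/4, 7π/4}`
has every lattice step `θ_h(x + e_i) − θ_h(x) ∈ {π/2, −3π/2} ⊆ π/2 + 2πℤ`: along direction `i` only the `i`-th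
representative moves, by `+1` or — at the wrap-around `val = L − 1 ↦ 0` — by `1 − L ≡ 1 (mod 4)`
(`hb_sum_step`, `hb_helix_step`).  Hence the box of half-width `δ ≤ π/4` around `θ_h` lies in the cube
`[0, 2π]^Λ`, and for `θ` in the box every bond angle is `π/2 + u (mod 2π)` with `|u| ≤ 2δ`, so every current is
`sin(π/2 + u) = cos u ≥ 1 − u²/2 ≥ 1 − 2δ²` and every bond cosine is `cos(π/2 + u) = −sin u ≥ −|u| ≥ −2δ`
(`hb_bond_bounds`).  Elementary trigonometry and `ZMod` bookkeeping; no literature input.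
-/

noncomputable section

namespace Summit.HubbardSuperconductivity.HubbardSuperconductivity.Theorems.PerturbedXYOrder

open MeasureTheory Literature.Probability.LatticeModels
open Summit.HubbardSuperconductivity.HubbardSuperconductivity.Theses.NodalWardXY

/-- One lattice step on the torus (`2 ≤ L`): along direction `i` the sum of representatives
`x₀.val + x₁.val + x₂.val` increases by `1`, or (wrap-around of the `i`-th coordinate) by `1 − L`. -/
theorem hb_sum_step {L : ℕ} [NeZero L] (hL : 2 ≤ L) (x : TorusSite 3 L) (i : Fin 3) :
    ((x + Pi.single i 1 : TorusSite 3 L) 0).val + ((x + Pi.single i 1 : TorusSite 3 L) 1).val +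
          ((x + Pi.single i 1 : TorusSite 3 L) 2).val = (x 0).val + (x 1).val + (x 2).val + 1 ∨
      ((x + Pi.single i 1 : TorusSite 3 L) 0).val + ((x + Pi.single i 1 : TorusSite 3 L) 1).val +
          ((x + Pi.single i 1 : TorusSite 3 L) 2).val + L = (x 0).val + (x 1).val + (x 2).val + 1 := by
  haveI : Fact (1 < L) := ⟨hL⟩
  -- the `i`-th representative moves by `+1`, or wraps from `L - 1` to `0`
  have hstep : (x i + 1).val = (x i).val + 1 ∨ (x i + 1).val + L = (x i).val + 1 := by
    rw [ZMod.val_add, ZMod.val_one]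
    have ha := ZMod.val_lt (x i)
    rcases Nat.lt_or_ge ((x i).val + 1) L with h | h
    · exact Or.inl (Nat.mod_eq_of_lt h)
    · right
      have hx : (x i).val + 1 = L := le_antisymm ha h
      rw [hx, Nat.mod_self]
      omega
  -- the other two representatives do not move
  have hS : ∀ y : TorusSite 3 L, (y 0).val + (y 1).val + (y 2).val = ∑ j, (y j).val := fun y =>
    (Fin.sum_univ_three (fun j => (y j).val)).symm
  have hi : (x + Pi.single i 1 : TorusSite 3 L) i = x i + 1 := by
    rw [Pi.add_apply, Pi.single_eq_same]
  have hrest : ∀ j : Fin 2, (x + Pi.single i 1 : TorusSite 3 L) (i.succAbove j) = x (i.succAbove j) :=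
    fun j => by rw [Pi.add_apply, Pi.single_eq_of_ne (Fin.succAbove_ne i j), add_zero]
  rw [hS (x + Pi.single i 1 : TorusSite 3 L), hS x, Fin.sum_univ_succAbove _ i,
    Fin.sum_univ_succAbove (fun j => (x j).val) i, hi]
  simp only [hrest]
  omega

/-- The helix step (`4 ∣ L`): `θ_h(x + e_i) − θ_h(x) = π/2 (mod 2π)` for
`θ_h(x) = π/4 + (π/2)((x₀.val + x₁.val + x₂.val) mod 4)` — the step of the representative sum is `+1` or
`1 − L ≡ 1 (mod 4)`, so its residue mod `4` moves by `+1` or by `−3`. -/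
theorem hb_helix_step {L : ℕ} [NeZero L] (h4 : 4 ∣ L) (x : TorusSite 3 L) (i : Fin 3) :
    ∃ m : ℤ,
      (Real.pi / 4 + Real.pi / 2 *
            (((((x + Pi.single i 1 : TorusSite 3 L) 0).val + ((x + Pi.single i 1 : TorusSite 3 L) 1).val +
                  ((x + Pi.single i 1 : TorusSite 3 L) 2).val) % 4 : ℕ) : ℝ)) -
          (Real.pi / 4 + Real.pi / 2 * ((((x 0).val + (x 1).val + (x 2).val) % 4 : ℕ) : ℝ)) =
        Real.pi / 2 + m * (2 * Real.pi) := by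
  obtain ⟨k, hk⟩ := h4
  have hL : 2 ≤ L := by have := NeZero.pos L; omega
  have hsum := hb_sum_step hL x i
  generalize ((x + Pi.single i 1 : TorusSite 3 L) 0).val + ((x + Pi.single i 1 : TorusSite 3 L) 1).val +
      ((x + Pi.single i 1 : TorusSite 3 L) 2).val = S' at hsum ⊢
  generalize (x 0).val + (x 1).val + (x 2).val = S at hsum ⊢
  have hmod : S' % 4 = S % 4 + 1 ∨ (S' % 4 = 0 ∧ S % 4 = 3) := by omega
  rcases hmod with h1 | ⟨h1, h2⟩
  · refine ⟨0, ?_⟩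
    rw [h1]
    push_cast
    ring
  · refine ⟨-1, ?_⟩
    rw [h1, h2]
    push_cast
    ring

/-- Bond bounds near a `π/2`-step configuration: if every step of `h` is `π/2 (mod 2π)` and `θ` lies in the box
of half-width `δ ≥ 0` around `h`, then every bond angle of `θ` is `π/2 + u (mod 2π)` with `|u| ≤ 2δ`, so every
current is `cos u ≥ 1 − u²/2 ≥ 1 − 2δ²` and every bond cosine is `−sin u ≥ −|u| ≥ −2δ`. -/
theorem hb_bond_bounds {L : ℕ} (h θ : TorusSite 3 L → ℝ) {δ : ℝ} (hδ : 0 ≤ δ)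
    (hθ : θ ∈ Set.pi Set.univ fun x => Set.Icc (h x - δ) (h x + δ))
    (hstep : ∀ (x : TorusSite 3 L) (i : Fin 3), ∃ m : ℤ,
      h (x + Pi.single i 1 : TorusSite 3 L) - h x = Real.pi / 2 + m * (2 * Real.pi))
    (b : Bond L) :
    1 - 2 * δ ^ 2 ≤ cur b θ ∧ -(2 * δ) ≤ Real.cos (θ (b.1 + Pi.single b.2 1) - θ b.1) := by
  have hclose : ∀ x, |θ x - h x| ≤ δ := fun x => by
    have hx := Set.mem_univ_pi.mp hθ x
    rw [Set.mem_Icc] at hx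
    exact abs_sub_le_iff.mpr ⟨by linarith [hx.2], by linarith [hx.1]⟩
  obtain ⟨m, hm⟩ := hstep b.1 b.2
  -- the fluctuation of the bond angle around the step of `h`
  obtain ⟨u, hu⟩ :
      ∃ u : ℝ, u = (θ (b.1 + Pi.single b.2 1) - h (b.1 + Pi.single b.2 1)) - (θ b.1 - h b.1) :=
    ⟨_, rfl⟩
  have hu2 : |u| ≤ 2 * δ := by
    calc |u| ≤ |θ (b.1 + Pi.single b.2 1) - h (b.1 + Pi.single b.2 1)| + |θ b.1 - h b.1| := by
          rw [hu]; exact abs_sub _ _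
      _ ≤ δ + δ := add_le_add (hclose _) (hclose _)
      _ = 2 * δ := by ring
  have hφ : θ (b.1 + Pi.single b.2 1) - θ b.1 = u + Real.pi / 2 + m * (2 * Real.pi) := by
    rw [hu]; linarith
  constructor
  · show 1 - 2 * δ ^ 2 ≤ Real.sin (θ (b.1 + Pi.single b.2 1) - θ b.1)
    rw [hφ, Real.sin_add_int_mul_two_pi, Real.sin_add_pi_div_two]
    have hc : 1 - u ^ 2 / 2 ≤ Real.cos u := Real.one_sub_sq_div_two_le_cos
    have hsq : u ^ 2 ≤ (2 * δ) ^ 2 :=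
      sq_le_sq.mpr (hu2.trans (abs_of_nonneg (mul_nonneg zero_le_two hδ)).symm.le)
    linarith
  · rw [hφ, Real.cos_add_int_mul_two_pi, Real.cos_add_pi_div_two]
    have hs : Real.sin u ≤ 2 * δ := (le_abs_self _).trans (Real.abs_sin_le_abs.trans hu2)
    linarith

/-- STUB (c5 tightness, M): **the 90°-helix box** (`4 ∣ L`). Around `θ_h(x) = π/4 + (π/2)((x₀+x₁+x₂) mod 4) ∈ {π/4, 3π/4, 5π/4, 7π/4}`
(representatives `val ∈ {0,…,L−1}`; every step, including the wrap-around `1 − L ≡ 1 mod 4`, changes `θ_h` by `π/2` or `−3π/2`), the box of half-width `δ ≤ π/4` lies in the cube, and on it every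
current is `≥ 1 − 2δ²` (`sin(π/2 + u) = cos u ≥ 1 − u²/2`, `|u| ≤ 2δ`) and every bond cosine is `≥ −2δ`
(`cos(π/2 + u) = −sin u ≥ −|u|`). -/
theorem stub_e3HelixBox (L : ℕ) [NeZero L] (h4 : 4 ∣ L) (δ : ℝ) (hδ : 0 ≤ δ) (hδ' : δ ≤ Real.pi / 4) :
    ((Set.pi Set.univ fun x : TorusSite 3 L => Set.Icc ((fun x : TorusSite 3 L => Real.pi / 4 + Real.pi / 2 * ((((x 0).val + (x 1).val + (x 2).val) % 4 : ℕ) : ℝ)) x - δ) ((fun x : TorusSite 3 L => Real.pi / 4 + Real.pi / 2 * ((((x 0).val + (x 1).val + (x 2).val) % 4 : ℕ) : ℝ)) x + δ)) ⊆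
        cube L) ∧
    (∀ θ ∈ (Set.pi Set.univ fun x : TorusSite 3 L => Set.Icc ((fun x : TorusSite 3 L => Real.pi / 4 + Real.pi / 2 * ((((x 0).val + (x 1).val + (x 2).val) % 4 : ℕ) : ℝ)) x - δ) ((fun x : TorusSite 3 L => Real.pi / 4 + Real.pi / 2 * ((((x 0).val + (x 1).val + (x 2).val) % 4 : ℕ) : ℝ)) x + δ)),
      ∀ b : Bond L, 1 - 2 * δ ^ 2 ≤ cur b θ ∧ -(2 * δ) ≤ Real.cos (θ (b.1 + Pi.single b.2 1) - θ b.1)) := by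
  refine ⟨?_, fun θ hθ b => hb_bond_bounds _ θ hδ hθ (fun x i => hb_helix_step h4 x i) b⟩
  -- the box lies in the cube: `π/4 ≤ θ_h ≤ 7π/4` and `δ ≤ π/4`
  unfold cube
  refine Set.pi_mono fun x _ => ?_
  dsimp only
  have hπ := Real.pi_pos
  have h0 : (0 : ℝ) ≤ ((((x 0).val + (x 1).val + (x 2).val) % 4 : ℕ) : ℝ) := Nat.cast_nonneg _
  have h3 : ((((x 0).val + (x 1).val + (x 2).val) % 4 : ℕ) : ℝ) ≤ 3 := by
    have : ((x 0).val + (x 1).val + (x 2).val) % 4 ≤ 3 := by omega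
    exact_mod_cast this
  refine Set.Icc_subset_Icc ?_ ?_
  · nlinarith [mul_nonneg hπ.le h0]
  · nlinarith [mul_le_mul_of_nonneg_left h3 hπ.le]

end Summit.HubbardSuperconductivity.HubbardSuperconductivity.Theorems.PerturbedXYOrder

end
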